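/-
Copyright (c) 2026 The H21 project. Released under Apache 2.0 license.
-/
import Summits.RiemannHypothesis.RiemannHypothesis.Theorems.PfPersistenceIntruderCapacitanceVariational
import HarnessLib

/-!
# PF-persistence THEORY 3 (gen 11) — the INDEX LAW without witnesses and without dimension:
# `n₋(window) ≥ k` iff a `k`-dimensional coefficient subspace is super-critical
# (publication cell `pub-rhpf`, theory seat 3)

Framing (page 1 of every `pub-rhpf` file): **mechanism/rigidity campaign — nothing here is a claim
about RH.** Everything below is PROVED abstract linear algebra / point-set topology of `ℝ^ι` — no
definitions, no statement about `ζ` or any control family; words of record: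
`run/shared/lean/pub/pub-rhpf/pub-rhpf-theory-3/THEORY-INTRUDER.md` §16.

WHAT.  For a split window `T = B − ∑ᵢ |vᵢ⟩⟨vᵢ|` (`S : OffLineSplitN T ι`: `B` symmetric, `B ≥ 0`, on a
real inner-product space `E` of ANY dimension, finitely many drivers) gen 10 proved the witness-free
HALF of the multi-driver secular law: a `k`-dimensional `T`-negative subspace yields a `k`-dimensional
COEFFICIENT subspace `C ⊆ ℝ^ι` every nonzero member of which is SUPER-CRITICAL — some trial vector
`x` has `|c|² < 2∑cᵢ⟪vᵢ,x⟫ − ⟪Bx,x⟫` (`exists_coeffSubspace_of_negSubspace_split`); the converse was in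
tree only in WITNESS form (`secular_law`, finite dimension, `B` coercive).  This file proves the
converse with NO witness, NO positivity beyond `B ≥ 0`, NO dimension or completeness assumption:

* `inner_apply_self_le_trialDefect` — the BORDERED IDENTITY `|c|² − (2∑cᵢ⟪vᵢ,x⟫ − ⟪Bx,x⟫) =
  ∑ᵢ(cᵢ − ⟪vᵢ,x⟫)² + ⟪Tx,x⟫` (Haynsworth's additivity with the identity block as pivot — no inverse):
  a super-critical pair `(c, x)` certifies `⟪Tx,x⟫ < 0` with the trial vector ITSELF.
* `exists_finset_uniform_trial` — COMPACTNESS of the unit sphere of `C`: finitely many trial vectors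
  (chosen in any prescribed set `D` that contains one trial vector per `c`) and ONE margin `δ > 0`
  serve every `c ∈ C ∖ 0`, with `|c|² < 2∑cᵢ⟪vᵢ,x⟫ − ⟪Bx,x⟫ − δ‖x‖²`, `x ∈ span`.
* `exists_weakWitnesses` — on a finite-dimensional subspace `W` every form `⟪f·,·⟫` positive on
  `W ∖ 0` has weak solutions `zᵢ ∈ W` of `⟪f zᵢ, y⟫ = ⟪vᵢ, y⟫ (y ∈ W)` (dual-space count; used with
  `f = B + δ`).
* `trialDefect_witnessSum_le` — the witness combination `∑cᵢzᵢ` MINIMISES the regularised defect over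
  `W` (Dirichlet principle for `B + δ` on `W`).
* `negSubspace_of_coeffSubspace` / `negSubspace_iff_coeffSubspace` — **THE INDEX LAW, hypothesis-free:
  for every `k`, `T < 0` on some `k`-dimensional subspace iff some `k`-dimensional coefficient
  subspace is super-critical**; `negSubspace_iff_coeffSubspace_iSup`: iff `|c|² < 𝔰(c) :=
  ⨆ₓ (2∑cᵢ⟪vᵢ,x⟫ − ⟪Bx,x⟫) ∈ EReal` on `C ∖ 0` (the `k`-dimensional form of gen 10's '`1 < 𝔰`');
  `negSubspace_of_coeffSubspace_le`: the negative subspace can be taken inside the span of the trial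
  vectors.
So `n₋(window)` = the largest dimension of a super-critical coefficient subspace, at every window of
every family, with no premise; PD certificates / witnesses only EVALUATE `𝔰(c) = cᵀMc`.
PLACEMENT (prior art, searched): this is the finite-rank BIRMAN–SCHWINGER PRINCIPLE (Birman 1961,
Schwinger 1961; [FrankLaptevWeidl2022, Thm 1.52]: `#{λ(A − B) < 0} = #{λ(𝓑_a) > 1}`) in the
degenerate case `B ≥ 0` WITH KERNEL ALLOWED (there (1.63) asks `a[u] > 0`): the energy space `𝓗_a`
is replaced by the convex-dual capacitance `𝔰` (a supremum, `+∞` admitted), and Glazman's lemma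
[FrankLaptevWeidl2022, Thm 1.25] by the explicit construction §3–§6.  A kernel-checked variant, not
a new theorem of spectral theory.
NOT proved here: anything about a continuum window object (door E-N), any value of any `𝔰`, DATA.
Don't-look sentence (RULING A24 k4): every statement holds for any split — DH, Epstein, planted
controls and `ζ` alike; nothing here separates `ζ` from a control.

## References
* R. L. Frank, A. Laptev, T. Weidl, *Schrödinger Operators: Eigenvalues and Lieb–Thirring
  Inequalities* (2022), Thm 1.25 (Glazman's lemma), Thm 1.52 (Birman–Schwinger principle).
  [FrankLaptevWeidl2022]
* E. V. Haynsworth, Linear Algebra Appl. 1 (1968) 73–81 (inertia additivity). [Haynsworth1968]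
* R. A. Horn, C. R. Johnson, *Matrix Analysis*, 2nd ed. (2013), Thm 4.3.28, Cor. 7.7.4.
  [HornJohnson2013]
* R. T. Rockafellar, *Convex Analysis* (1970), §12. [Rockafellar1970]
* G. H. Golub, C. F. Van Loan, *Matrix Computations*, 4th ed. (2013), §11.3.1. [GolubVanLoan2013]
-/

open scoped InnerProductSpace BigOperators
open Filter Topology

set_option linter.dupNamespace false

namespace Summit.RiemannHypothesis.RiemannHypothesis.Theorems.PfPersistenceIntruderCapacitanceIndex

open Summit.RiemannHypothesis.RiemannHypothesis.Theorems.PfPersistenceIntruderShadowMulti (OffLineSplitN)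
open Summit.RiemannHypothesis.RiemannHypothesis.Theorems.PfPersistenceIntruderCapacitanceVariational
  (inner_apply_smul_self exists_coeffSubspace_of_negSubspace_split)

variable {E : Type*} [NormedAddCommGroup E] [InnerProductSpace ℝ E]
variable {ι : Type*} [Fintype ι] {T : E →ₗ[ℝ] E}

/-! ## 1. The bordered identity: a super-critical pair certifies a negative vector -/

/-- **Bordered identity** (Haynsworth additivity with the identity block as pivot, no inverse): the
trial DEFECT of `(c, x)` is the moment mismatch plus the window form,
`|c|² − (2∑cᵢ⟪vᵢ,x⟫ − ⟪Bx,x⟫) = ∑ᵢ (cᵢ − ⟪vᵢ,x⟫)² + ⟪Tx,x⟫`.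
[cite: Haynsworth1968, inertia additivity formula; HornJohnson2013, Thm 4.3.28] -/
theorem trialDefect_eq (S : OffLineSplitN T ι) (c : ι → ℝ) (x : E) :
    ∑ i, c i ^ 2 - (2 * ∑ i, c i * ⟪S.v i, x⟫_ℝ - ⟪S.B x, x⟫_ℝ) =
      ∑ i, (c i - ⟪S.v i, x⟫_ℝ) ^ 2 + ⟪T x, x⟫_ℝ := by
  rw [S.inner_apply_self]
  have h : ∑ i, (c i - ⟪S.v i, x⟫_ℝ) ^ 2 =
      ∑ i, c i ^ 2 - 2 * ∑ i, c i * ⟪S.v i, x⟫_ℝ + ∑ i, ⟪S.v i, x⟫_ℝ ^ 2 := by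
    rw [Finset.mul_sum, ← Finset.sum_sub_distrib, ← Finset.sum_add_distrib]
    exact Finset.sum_congr rfl fun i _ => by ring
  rw [h]; ring

/-- The window form is bounded by every trial defect: `⟪Tx,x⟫ ≤ |c|² − (2∑cᵢ⟪vᵢ,x⟫ − ⟪Bx,x⟫)`
(equality iff `cᵢ = ⟪vᵢ,x⟫`). [cite: Haynsworth1968, inertia additivity formula] -/
theorem inner_apply_self_le_trialDefect (S : OffLineSplitN T ι) (c : ι → ℝ) (x : E) :
    ⟪T x, x⟫_ℝ ≤ ∑ i, c i ^ 2 - (2 * ∑ i, c i * ⟪S.v i, x⟫_ℝ - ⟪S.B x, x⟫_ℝ) := by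
  rw [trialDefect_eq]
  have h := Finset.sum_nonneg fun i (_ : i ∈ Finset.univ) => sq_nonneg (c i - ⟪S.v i, x⟫_ℝ)
  linarith

/-- **One-vector certificate**: a super-critical pair `|c|² < 2∑cᵢ⟪vᵢ,x⟫ − ⟪Bx,x⟫` certifies that the
trial vector `x` ITSELF is a negative vector of the window (one matrix–vector product, no inverse,
no PD step, any dimension). [cite: Haynsworth1968, inertia additivity formula] -/
theorem inner_apply_self_neg_of_trial (S : OffLineSplitN T ι) {c : ι → ℝ} {x : E}
    (h : ∑ i, c i ^ 2 < 2 * ∑ i, c i * ⟪S.v i, x⟫_ℝ - ⟪S.B x, x⟫_ℝ) : ⟪T x, x⟫_ℝ < 0 := by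
  have h' := inner_apply_self_le_trialDefect S c x
  linarith

/-- With the moment vector `cᵢ = ⟪vᵢ,x⟫` the defect IS the window form. [folklore] -/
theorem trialDefect_moment_eq (S : OffLineSplitN T ι) (x : E) :
    ∑ i, ⟪S.v i, x⟫_ℝ ^ 2 - (2 * ∑ i, ⟪S.v i, x⟫_ℝ * ⟪S.v i, x⟫_ℝ - ⟪S.B x, x⟫_ℝ) = ⟪T x, x⟫_ℝ := by
  rw [trialDefect_eq]; simp

/-! ## 2. Scaling -/

/-- The regularised trial gap is homogeneous of degree two in `(c, x)` jointly. [folklore] -/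
theorem trialGap_smul (B : E →ₗ[ℝ] E) (v : ι → E) (δ r : ℝ) (c : ι → ℝ) (x : E) :
    2 * ∑ i, (r • c) i * ⟪v i, r • x⟫_ℝ - ⟪B (r • x), r • x⟫_ℝ - δ * ‖r • x‖ ^ 2 -
        ∑ i, (r • c) i ^ 2 =
      r ^ 2 * (2 * ∑ i, c i * ⟪v i, x⟫_ℝ - ⟪B x, x⟫_ℝ - δ * ‖x‖ ^ 2 - ∑ i, c i ^ 2) := by
  have h1 : ∑ i, (r • c) i * ⟪v i, r • x⟫_ℝ = r ^ 2 * ∑ i, c i * ⟪v i, x⟫_ℝ := by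
    rw [Finset.mul_sum]
    exact Finset.sum_congr rfl fun i _ => by
      rw [Pi.smul_apply, smul_eq_mul, real_inner_smul_right]; ring
  have h2 : ∑ i, (r • c) i ^ 2 = r ^ 2 * ∑ i, c i ^ 2 := by
    rw [Finset.mul_sum]
    exact Finset.sum_congr rfl fun i _ => by rw [Pi.smul_apply, smul_eq_mul]; ring
  have h3 : ‖r • x‖ ^ 2 = r ^ 2 * ‖x‖ ^ 2 := by
    rw [norm_smul, mul_pow, Real.norm_eq_abs, sq_abs]
  rw [h1, h2, inner_apply_smul_self, h3]; ring

/-! ## 3. Compactness of the coefficient sphere: finitely many trial vectors, one margin -/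

/-- **Uniform finite trial family.**  If every nonzero `c` of a coefficient subspace `C ⊆ ℝ^ι` has a
trial vector in `D` with `|c|² < 2∑cᵢ⟪vᵢ,x⟫ − ⟪Bx,x⟫`, then FINITELY many trial vectors `s ⊆ D` and
ONE margin `δ > 0` serve all of `C ∖ 0`: `|c|² < 2∑cᵢ⟪vᵢ,x⟫ − ⟪Bx,x⟫ − δ‖x‖²` for some `x ∈ span s`
(compactness of the unit sphere of `C`; the conditions are open in `c` and jointly homogeneous).
No hypothesis on `B`, `v`. [folklore] -/
theorem exists_finset_uniform_trial (B : E →ₗ[ℝ] E) (v : ι → E) (C : Submodule ℝ (ι → ℝ))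
    {D : Set E} (hC : ∀ c ∈ C, c ≠ 0 → ∃ x ∈ D,
      ∑ i, c i ^ 2 < 2 * ∑ i, c i * ⟪v i, x⟫_ℝ - ⟪B x, x⟫_ℝ) :
    ∃ s : Finset E, (s : Set E) ⊆ D ∧ ∃ δ : ℝ, 0 < δ ∧ ∀ c ∈ C, c ≠ 0 →
      ∃ x ∈ Submodule.span ℝ (s : Set E),
        ∑ i, c i ^ 2 < 2 * ∑ i, c i * ⟪v i, x⟫_ℝ - ⟪B x, x⟫_ℝ - δ * ‖x‖ ^ 2 := by
  classical
  set K : Set (ι → ℝ) := Metric.sphere (0 : ι → ℝ) 1 ∩ (C : Set (ι → ℝ)) with hK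
  have hKc : IsCompact K :=
    (isCompact_sphere (0 : ι → ℝ) 1).inter_right C.closed_of_finiteDimensional
  let O : E × ℝ → Set (ι → ℝ) := fun p =>
    {c | (p.1 ∈ D ∧ 0 < p.2) ∧
      ∑ i, c i ^ 2 < 2 * ∑ i, c i * ⟪v i, p.1⟫_ℝ - ⟪B p.1, p.1⟫_ℝ - p.2 * ‖p.1‖ ^ 2}
  have hO : ∀ p, IsOpen (O p) := fun p => by
    show IsOpen {c : ι → ℝ | (p.1 ∈ D ∧ 0 < p.2) ∧
      ∑ i, c i ^ 2 < 2 * ∑ i, c i * ⟪v i, p.1⟫_ℝ - ⟪B p.1, p.1⟫_ℝ - p.2 * ‖p.1‖ ^ 2}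
    rw [Set.setOf_and]
    exact isOpen_const.inter (isOpen_lt (by fun_prop) (by fun_prop))
  have hcov : K ⊆ ⋃ p, O p := by
    rintro c ⟨hc1, hcC⟩
    have hc0 : c ≠ 0 := by
      rw [mem_sphere_zero_iff_norm] at hc1
      exact ne_zero_of_norm_ne_zero (by rw [hc1]; exact one_ne_zero)
    obtain ⟨x, hxD, hx⟩ := hC c hcC hc0
    set g := 2 * ∑ i, c i * ⟪v i, x⟫_ℝ - ⟪B x, x⟫_ℝ - ∑ i, c i ^ 2 with hg
    have hgpos : 0 < g := by rw [hg]; linarith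
    refine Set.mem_iUnion.mpr ⟨(x, g / (2 * (‖x‖ ^ 2 + 1))), ⟨hxD, by positivity⟩, ?_⟩
    show ∑ i, c i ^ 2 <
      2 * ∑ i, c i * ⟪v i, x⟫_ℝ - ⟪B x, x⟫_ℝ - g / (2 * (‖x‖ ^ 2 + 1)) * ‖x‖ ^ 2
    have hle : g / (2 * (‖x‖ ^ 2 + 1)) * ‖x‖ ^ 2 ≤ g / 2 := by
      rw [div_mul_eq_mul_div, div_le_div_iff₀ (by positivity) (by positivity)]
      nlinarith [sq_nonneg ‖x‖, hgpos]
    linarith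
  obtain ⟨t, ht⟩ := hKc.elim_finite_subcover O hO hcov
  let t' : Finset (E × ℝ) := t.filter fun p => p.1 ∈ D ∧ 0 < p.2
  let Δ : Finset ℝ := insert 1 (t'.image Prod.snd)
  have hΔ : Δ.Nonempty := Finset.insert_nonempty _ _
  have hδpos : 0 < Δ.min' hΔ := by
    rw [Finset.lt_min'_iff]
    intro y hy
    rcases Finset.mem_insert.mp hy with rfl | hy
    · exact one_pos
    · obtain ⟨p, hp, rfl⟩ := Finset.mem_image.mp hy
      exact (Finset.mem_filter.mp hp).2.2
  have hδle : ∀ p ∈ t', Δ.min' hΔ ≤ p.2 := fun p hp =>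
    Finset.min'_le _ _ (Finset.mem_insert_of_mem (Finset.mem_image_of_mem _ hp))
  refine ⟨t'.image Prod.fst, ?_, Δ.min' hΔ, hδpos, ?_⟩
  · intro x hx
    obtain ⟨p, hp, rfl⟩ := Finset.mem_image.mp (Finset.mem_coe.mp hx)
    exact (Finset.mem_filter.mp hp).2.1
  intro c hcC hc0
  have hr : 0 < ‖c‖ := norm_pos_iff.mpr hc0
  have hĉK : ‖c‖⁻¹ • c ∈ K := by
    refine ⟨?_, C.smul_mem _ hcC⟩
    rw [mem_sphere_zero_iff_norm, norm_smul, norm_inv, norm_norm, inv_mul_cancel₀ hr.ne']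
  obtain ⟨p, hp, ⟨hpD, hp2⟩, hineq⟩ := Set.mem_iUnion₂.mp (ht hĉK)
  have hpt' : p ∈ t' := Finset.mem_filter.mpr ⟨hp, hpD, hp2⟩
  refine ⟨‖c‖ • p.1, Submodule.smul_mem _ _
    (Submodule.subset_span (Finset.mem_coe.mpr (Finset.mem_image_of_mem _ hpt'))), ?_⟩
  have key := trialGap_smul B v (Δ.min' hΔ) ‖c‖ (‖c‖⁻¹ • c) p.1
  rw [smul_inv_smul₀ hr.ne'] at key
  have hgap : 0 < 2 * ∑ i, (‖c‖⁻¹ • c) i * ⟪v i, p.1⟫_ℝ - ⟪B p.1, p.1⟫_ℝ -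
      Δ.min' hΔ * ‖p.1‖ ^ 2 - ∑ i, (‖c‖⁻¹ • c) i ^ 2 := by
    have h1 : Δ.min' hΔ * ‖p.1‖ ^ 2 ≤ p.2 * ‖p.1‖ ^ 2 :=
      mul_le_mul_of_nonneg_right (hδle p hpt') (sq_nonneg _)
    linarith
  have hpos : 0 < ‖c‖ ^ 2 * (2 * ∑ i, (‖c‖⁻¹ • c) i * ⟪v i, p.1⟫_ℝ - ⟪B p.1, p.1⟫_ℝ -
      Δ.min' hΔ * ‖p.1‖ ^ 2 - ∑ i, (‖c‖⁻¹ • c) i ^ 2) := mul_pos (by positivity) hgap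
  linarith

/-! ## 4. Weak witnesses on a finite-dimensional subspace -/

omit [Fintype ι] in
/-- **Weak witnesses.**  On a finite-dimensional subspace `W`, if `⟪f y, y⟫ > 0` for `y ∈ W ∖ 0`
then every driver has a weak solution `zᵢ ∈ W` of `⟪f zᵢ, y⟫ = ⟪vᵢ, y⟫` for all `y ∈ W`
(`z ↦ ⟪f z, ·⟫|_W : W → W*` is injective, hence onto by the dimension count).  Used with
`f = B + δ·1`, `δ > 0` — no positivity of `B` beyond `B ≥ 0`, no completeness of `E`. [folklore] -/
theorem exists_weakWitnesses (W : Submodule ℝ E) [FiniteDimensional ℝ W] (f : E →ₗ[ℝ] E)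
    (hpos : ∀ y : W, y ≠ 0 → 0 < ⟪f y, y⟫_ℝ) (v : ι → E) :
    ∃ z : ι → W, ∀ (i : ι) (y : W), ⟪f (z i), y⟫_ℝ = ⟪v i, y⟫_ℝ := by
  let Θ : W →ₗ[ℝ] Module.Dual ℝ W :=
    W.subtype.dualMap ∘ₗ (innerₛₗ ℝ : E →ₗ[ℝ] E →ₗ[ℝ] ℝ) ∘ₗ f ∘ₗ W.subtype
  have hΘ : ∀ z y : W, Θ z y = ⟪f z, y⟫_ℝ := fun z y => rfl
  have hinj : Function.Injective Θ := by
    rw [← LinearMap.ker_eq_bot, LinearMap.ker_eq_bot']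
    intro z hz
    by_contra h0
    have h := hpos z h0
    rw [← hΘ, hz, LinearMap.zero_apply] at h
    exact lt_irrefl _ h
  have hsurj : Function.Surjective Θ :=
    (LinearMap.injective_iff_surjective_of_finrank_eq_finrank
      (Subspace.dual_finrank_eq).symm).mp hinj
  choose z hz using fun i => hsurj (W.subtype.dualMap (innerₛₗ ℝ (v i)))
  exact ⟨z, fun i y => by rw [← hΘ, hz]; rfl⟩

/-! ## 5. The witness combination minimises the regularised defect -/

/-- **Dirichlet principle on `W` for `B + δ`.**  With weak witnesses `⟪B zᵢ + δ zᵢ, y⟫ = ⟪vᵢ, y⟫`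
(`y ∈ W`), the combination `w = ∑ cᵢ zᵢ` minimises the regularised defect
`|c|² − (2∑cᵢ⟪vᵢ,x⟫ − ⟪Bx,x⟫ − δ‖x‖²)` over `x ∈ W` (the difference is
`⟪B(x − w), x − w⟫ + δ‖x − w‖² ≥ 0`). [cite: GolubVanLoan2013, §11.3.1] -/
theorem trialDefect_witnessSum_le (B : E →ₗ[ℝ] E) (hsymm : ∀ x y : E, ⟪B x, y⟫_ℝ = ⟪x, B y⟫_ℝ)
    (hnonneg : ∀ x : E, 0 ≤ ⟪B x, x⟫_ℝ) (v : ι → E) {δ : ℝ} (hδ : 0 ≤ δ) (W : Submodule ℝ E)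
    (z : ι → W) (hz : ∀ (i : ι) (y : W), ⟪B (z i) + δ • (z i : E), y⟫_ℝ = ⟪v i, y⟫_ℝ)
    (c : ι → ℝ) {x : E} (hx : x ∈ W) :
    ∑ i, c i ^ 2 - (2 * ∑ i, c i * ⟪v i, ∑ j, c j • (z j : E)⟫_ℝ -
        ⟪B (∑ j, c j • (z j : E)), ∑ j, c j • (z j : E)⟫_ℝ - δ * ‖∑ j, c j • (z j : E)‖ ^ 2) ≤
      ∑ i, c i ^ 2 - (2 * ∑ i, c i * ⟪v i, x⟫_ℝ - ⟪B x, x⟫_ℝ - δ * ‖x‖ ^ 2) := by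
  set w : E := ∑ j, c j • (z j : E) with hw
  have hwW : w ∈ W := W.sum_mem fun j _ => W.smul_mem _ (z j).2
  have hlin : B w + δ • w = ∑ i, c i • (B (z i) + δ • (z i : E)) := by
    rw [hw, map_sum, Finset.smul_sum, ← Finset.sum_add_distrib]
    exact Finset.sum_congr rfl fun i _ => by rw [map_smul, smul_add, smul_comm δ (c i)]
  have hf : ∀ y ∈ W, ⟪B w, y⟫_ℝ + δ * ⟪w, y⟫_ℝ = ∑ i, c i * ⟪v i, y⟫_ℝ := by
    intro y hy
    calc ⟪B w, y⟫_ℝ + δ * ⟪w, y⟫_ℝ = ⟪B w + δ • w, y⟫_ℝ := by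
            rw [inner_add_left, real_inner_smul_left]
      _ = ∑ i, c i * ⟪B (z i) + δ • (z i : E), y⟫_ℝ := by
            rw [hlin, sum_inner]
            exact Finset.sum_congr rfl fun i _ => by rw [real_inner_smul_left]
      _ = ∑ i, c i * ⟪v i, y⟫_ℝ := Finset.sum_congr rfl fun i _ => by rw [hz i ⟨y, hy⟩]
  have hQ : 0 ≤ ⟪B (x - w), x - w⟫_ℝ + δ * ‖x - w‖ ^ 2 :=
    add_nonneg (hnonneg _) (mul_nonneg hδ (sq_nonneg _))
  have e1 : ⟪B (x - w), x - w⟫_ℝ = ⟪B x, x⟫_ℝ - 2 * ⟪B w, x⟫_ℝ + ⟪B w, w⟫_ℝ := by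
    rw [map_sub, inner_sub_left, inner_sub_right, inner_sub_right, hsymm x w,
      real_inner_comm (B w) x]
    ring
  have e2 : ‖x - w‖ ^ 2 = ‖x‖ ^ 2 - 2 * ⟪w, x⟫_ℝ + ‖w‖ ^ 2 := by
    rw [norm_sub_sq_real, real_inner_comm]
  have e3 : ‖w‖ ^ 2 = ⟪w, w⟫_ℝ := (real_inner_self_eq_norm_sq w).symm
  have hx' := hf x hx
  have hw' := hf w hwW
  rw [e1, e2] at hQ
  nlinarith [hQ, hx', hw', e3]

/-! ## 6. The index law -/

/-- **Construction.**  From a `k`-dimensional coefficient subspace `C` served by finitely many trial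
vectors `s` with one margin `δ > 0` (§3), a `k`-dimensional `T`-negative subspace INSIDE `span s`:
weak witnesses `zᵢ ∈ span s` for `B + δ` (§4), `Z c = ∑cᵢzᵢ`; then for `c ∈ C ∖ 0`,
`⟪T(Zc), Zc⟫ ≤ defect(c, Zc) ≤ defect_δ(c, Zc) ≤ defect_δ(c, x) < 0` (§1, §5), so `Z` is injective
on `C` and `Z(C)` is the subspace. [cite: Haynsworth1968, inertia additivity formula;
HornJohnson2013, Cor. 7.7.4] -/
theorem negSubspace_of_uniform_trial (S : OffLineSplitN T ι) (C : Submodule ℝ (ι → ℝ)) {k : ℕ}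
    (hCk : Module.finrank ℝ C = k) (s : Finset E) {δ : ℝ} (hδ : 0 < δ)
    (hcov : ∀ c ∈ C, c ≠ 0 → ∃ x ∈ Submodule.span ℝ (s : Set E),
      ∑ i, c i ^ 2 < 2 * ∑ i, c i * ⟪S.v i, x⟫_ℝ - ⟪S.B x, x⟫_ℝ - δ * ‖x‖ ^ 2) :
    ∃ U : Submodule ℝ E, U ≤ Submodule.span ℝ (s : Set E) ∧ Module.finrank ℝ U = k ∧
      ∀ x ∈ U, x ≠ 0 → ⟪T x, x⟫_ℝ < 0 := by
  classical
  set W : Submodule ℝ E := Submodule.span ℝ (s : Set E) with hW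
  haveI : FiniteDimensional ℝ W := FiniteDimensional.span_of_finite ℝ s.finite_toSet
  set f : E →ₗ[ℝ] E := S.B + δ • LinearMap.id with hf
  have hfx : ∀ x : E, f x = S.B x + δ • x := fun x => by
    rw [hf, LinearMap.add_apply, LinearMap.smul_apply, LinearMap.id_apply]
  have hpos : ∀ y : W, y ≠ 0 → 0 < ⟪f y, y⟫_ℝ := by
    intro y hy
    have hy' : (y : E) ≠ 0 := fun h => hy (Subtype.ext h)
    rw [hfx, inner_add_left, real_inner_smul_left, real_inner_self_eq_norm_sq]
    have h1 := S.B_nonneg y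
    have h2 : 0 < ‖(y : E)‖ := norm_pos_iff.mpr hy'
    positivity
  obtain ⟨z, hz⟩ := exists_weakWitnesses W f hpos S.v
  have hz' : ∀ (i : ι) (y : W), ⟪S.B (z i) + δ • (z i : E), y⟫_ℝ = ⟪S.v i, y⟫_ℝ := by
    intro i y
    rw [← hfx]
    exact hz i y
  let Z : (ι → ℝ) →ₗ[ℝ] E := Fintype.linearCombination ℝ (fun i => (z i : E))
  have hZ : ∀ c, Z c = ∑ i, c i • (z i : E) := fun c => Fintype.linearCombination_apply _ _ _
  have hZW : ∀ c, Z c ∈ W := fun c => by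
    rw [hZ]; exact W.sum_mem fun j _ => W.smul_mem _ (z j).2
  have hneg : ∀ c ∈ C, c ≠ 0 → ⟪T (Z c), Z c⟫_ℝ < 0 := by
    intro c hcC hc0
    obtain ⟨x, hxW, hx⟩ := hcov c hcC hc0
    have h1 := trialDefect_witnessSum_le S.B S.B_symm S.B_nonneg S.v hδ.le W z hz' c hxW
    have h2 := inner_apply_self_le_trialDefect S c (Z c)
    rw [hZ] at h2 ⊢
    have h3 : 0 ≤ δ * ‖∑ j, c j • (z j : E)‖ ^ 2 := by positivity
    linarith
  have hinj : Function.Injective (Z ∘ₗ C.subtype) := by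
    rw [← LinearMap.ker_eq_bot, LinearMap.ker_eq_bot']
    intro c hc
    by_contra hc0
    have h := hneg c c.2 fun h => hc0 (Subtype.ext h)
    have hc' : Z c = 0 := hc
    rw [hc', map_zero, inner_zero_left] at h
    exact lt_irrefl _ h
  refine ⟨LinearMap.range (Z ∘ₗ C.subtype), ?_, by rw [LinearMap.finrank_range_of_inj hinj, hCk], ?_⟩
  · rintro _ ⟨c, rfl⟩; exact hZW c
  · rintro _ ⟨c, rfl⟩ hy
    have hc0 : (c : ι → ℝ) ≠ 0 := by
      intro h; apply hy
      show Z c = 0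
      rw [h, map_zero]
    exact hneg c c.2 hc0

/-- **The index law, converse half, hypothesis-free**: a `k`-dimensional super-critical coefficient
subspace gives a `k`-dimensional subspace on which the window form is negative definite — for every
split of every window in ANY real inner-product space; no witness, no `B > 0`, no dimension.
[cite: Haynsworth1968, inertia additivity formula; HornJohnson2013, Cor. 7.7.4] -/
theorem negSubspace_of_coeffSubspace (S : OffLineSplitN T ι) {k : ℕ}
    (h : ∃ C : Submodule ℝ (ι → ℝ), Module.finrank ℝ C = k ∧
      ∀ c ∈ C, c ≠ 0 → ∃ x : E, ∑ i, c i ^ 2 < 2 * ∑ i, c i * ⟪S.v i, x⟫_ℝ - ⟪S.B x, x⟫_ℝ) :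
    ∃ U : Submodule ℝ E, Module.finrank ℝ U = k ∧ ∀ x ∈ U, x ≠ 0 → ⟪T x, x⟫_ℝ < 0 := by
  obtain ⟨C, hCk, hC⟩ := h
  obtain ⟨s, -, δ, hδ, hcov⟩ := exists_finset_uniform_trial S.B S.v C (D := Set.univ)
    fun c hc hc0 => by obtain ⟨x, hx⟩ := hC c hc hc0; exact ⟨x, Set.mem_univ _, hx⟩
  obtain ⟨U, -, hU, hneg⟩ := negSubspace_of_uniform_trial S C hCk s hδ hcov
  exact ⟨U, hU, hneg⟩

/-- **THE INDEX LAW** (`n₋ = super-critical index`), hypothesis-free: for every split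
`T = B − ∑|vᵢ⟩⟨vᵢ|` (`B` symmetric, `B ≥ 0`) of a window in a real inner-product space of any
dimension and every `k`, the window form is negative definite on some `k`-dimensional subspace iff
some `k`-dimensional coefficient subspace `C ⊆ ℝ^ι` is super-critical: every `c ∈ C ∖ 0` has a trial
vector with `|c|² < 2∑cᵢ⟪vᵢ,x⟫ − ⟪Bx,x⟫`.  With witnesses `B zᵢ = vᵢ` the supremum of the right side
is `cᵀMc` and this is `secular_law` (`n₋ = #{μ(M) > 1}`), now with its premises removed — the
finite-rank Birman–Schwinger principle with `ker B` allowed.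
[cite: FrankLaptevWeidl2022, Thm 1.52; Haynsworth1968, inertia additivity formula;
HornJohnson2013, Cor. 7.7.4; Rockafellar1970, §12] -/
theorem negSubspace_iff_coeffSubspace (S : OffLineSplitN T ι) (k : ℕ) :
    (∃ U : Submodule ℝ E, Module.finrank ℝ U = k ∧ ∀ x ∈ U, x ≠ 0 → ⟪T x, x⟫_ℝ < 0) ↔
      ∃ C : Submodule ℝ (ι → ℝ), Module.finrank ℝ C = k ∧
        ∀ c ∈ C, c ≠ 0 → ∃ x : E, ∑ i, c i ^ 2 < 2 * ∑ i, c i * ⟪S.v i, x⟫_ℝ - ⟪S.B x, x⟫_ℝ :=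
  ⟨exists_coeffSubspace_of_negSubspace_split S, negSubspace_of_coeffSubspace S⟩

/-- **The index law in capacitance form**: `n₋(window) ≥ k` iff on some `k`-dimensional coefficient
subspace the `EReal` capacitance `𝔰(c) := ⨆ₓ (2∑cᵢ⟪vᵢ,x⟫ − ⟪Bx,x⟫) ∈ [0, ∞]` beats `|c|²` — the
`k`-dimensional form of gen 10's 'indefinite iff `1 < 𝔰`', hypothesis-free.
[cite: FrankLaptevWeidl2022, Thm 1.52; Rockafellar1970, §12] -/
theorem negSubspace_iff_coeffSubspace_iSup (S : OffLineSplitN T ι) (k : ℕ) :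
    (∃ U : Submodule ℝ E, Module.finrank ℝ U = k ∧ ∀ x ∈ U, x ≠ 0 → ⟪T x, x⟫_ℝ < 0) ↔
      ∃ C : Submodule ℝ (ι → ℝ), Module.finrank ℝ C = k ∧ ∀ c ∈ C, c ≠ 0 →
        ((∑ i, c i ^ 2 : ℝ) : EReal) <
          ⨆ x : E, ((2 * ∑ i, c i * ⟪S.v i, x⟫_ℝ - ⟪S.B x, x⟫_ℝ : ℝ) : EReal) := by
  rw [negSubspace_iff_coeffSubspace S k]
  refine exists_congr fun C => and_congr_right fun _ => forall₃_congr fun c _ _ => ?_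
  rw [lt_iSup_iff]
  exact exists_congr fun x => EReal.coe_lt_coe_iff.symm

/-- **Localisation**: if the trial vectors can all be found in a set `D`, the `k`-dimensional negative
subspace can be taken inside the span of FINITELY many elements of `D`. [folklore] -/
theorem negSubspace_of_coeffSubspace_le (S : OffLineSplitN T ι) {D : Set E} {k : ℕ}
    (h : ∃ C : Submodule ℝ (ι → ℝ), Module.finrank ℝ C = k ∧ ∀ c ∈ C, c ≠ 0 →
      ∃ x ∈ D, ∑ i, c i ^ 2 < 2 * ∑ i, c i * ⟪S.v i, x⟫_ℝ - ⟪S.B x, x⟫_ℝ) :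
    ∃ s : Finset E, (s : Set E) ⊆ D ∧ ∃ U : Submodule ℝ E, U ≤ Submodule.span ℝ (s : Set E) ∧
      Module.finrank ℝ U = k ∧ ∀ x ∈ U, x ≠ 0 → ⟪T x, x⟫_ℝ < 0 := by
  obtain ⟨C, hCk, hC⟩ := h
  obtain ⟨s, hsD, δ, hδ, hcov⟩ := exists_finset_uniform_trial S.B S.v C hC
  exact ⟨s, hsD, negSubspace_of_uniform_trial S C hCk s hδ hcov⟩

end Summit.RiemannHypothesis.RiemannHypothesis.Theorems.PfPersistenceIntruderCapacitanceIndex
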